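import Literature.AlgebraicGeometry.Motives.HodgeStructureEndAlgDiagonalization
import Mathlib.LinearAlgebra.Charpoly.BaseChange
import Mathlib.RingTheory.TensorProduct.Free
import Mathlib.LinearAlgebra.FiniteDimensional.Lemmas
import HarnessLib

/-!
# The determinant of a `K`-linear map on the eigenspace blocks `T_σ` (Zarhin's theorem, step 10a)

Let `H` be a `ℚ`-Hodge structure of weight `2` on a finite-dimensional `V` whose endomorphism
algebra `E = End_Hdg(V)` is a field (irreducible of K3 type: Huybrechts, *Lectures on K3
Surfaces*, Cor. 3.3.6, the tree's `Zarhin1983_endAlg_isField_holds`), `Z = Z(E) (= E)` its centre,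
and for a character `σ : E → ℂ` let `T_σ ⊆ V_ℂ = ℂ ⊗_ℚ V` be the block on which every `a ∈ E` acts
by `σ(a)` (Huybrechts Rem. 3.3.14 (iii): `T ⊗_ℚ ℂ = ⊕_σ T_σ`; van Geemen, *Real multiplication on
K3 surfaces*, §2.3). We prove the bookkeeping identity behind "`SO_K(T)` versus `SO(T_σ)`" in
Zarhin's theorem (Huybrechts Thm. 3.3.9; van Geemen Lemma 2.5: `SO(T, ψ)_K(ℂ) ≅ ∏_σ SO(T_σ)`):

* `iSup_iInf_eigenspace_baseChange_eq_top`: the blocks span `V_ℂ`;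
* `baseChange_mem_iInf_eigenspace`: a `ℚ`-linear `g` commuting with `E` has `g_ℂ(T_σ) ⊆ T_σ`;
* `det_restrict_baseChange_eq`: if `g` is the underlying map of a `Z`-linear `g'`, then
  `det_ℂ(g_ℂ|_{T_σ}) = σ(det_Z g')`; in particular (`det_restrict_baseChange_eq_one`)
  `det_Z g' = 1 ⟹ det_ℂ(g_ℂ|_{T_σ}) = 1` for every `σ`.

Proof of the determinant identity: the canonical surjection `Ψ_σ : ℂ ⊗_ℚ V → ℂ ⊗_{Z,σ} V`
(Mathlib's `TensorProduct.mapOfCompatibleSMul`) intertwines `g_ℂ` with the `σ`-base change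
`g' ⊗_Z ℂ`, multiplies by `σ(a)` after `a_ℂ` and hence kills every block `T_τ`, `τ ≠ σ`; since the
blocks span, `Ψ_σ|_{T_σ}` is onto the `d = dim_Z V`-dimensional `ℂ ⊗_Z V`, while
`dim T_σ ≤ d` (`finrank_eigenspace_baseChange_le_card`), so `Ψ_σ|_{T_σ}` is an isomorphism
conjugating `g_ℂ|_{T_σ}` to `g' ⊗_Z ℂ`, whose determinant is `σ(det_Z g')`
(`LinearMap.det_baseChange`). Pure linear algebra; no definitions, no named facts.

## References

* D. Huybrechts, *Lectures on K3 Surfaces*, CUP (2016), Thm. 3.3.9, Rem. 3.3.14 (iii).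
* B. van Geemen, *Real multiplication on K3 surfaces and Kuga–Satake varieties*, Michigan Math. J.
  56 (2008), §2.3, Lemma 2.5.
* Yu. G. Zarhin, *Hodge groups of K3 surfaces*, J. reine angew. Math. 341 (1983), §2.
-/

noncomputable section

open scoped TensorProduct

namespace Literature.AlgebraicGeometry.Motives

namespace HodgeStructure

universe u

variable {V : Type u} [AddCommGroup V] [Module ℚ V] {H : HodgeStructure V 2}

/-- **`g_ℂ` preserves every block `T_σ`** when `g` commutes with `E = End_Hdg(V)`: `a_ℂ g_ℂ x =
g_ℂ a_ℂ x = σ(a) g_ℂ x`. [folklore] -/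
theorem baseChange_mem_iInf_eigenspace (σ : H.endAlg →+* ℂ) {g : V →ₗ[ℚ] V}
    (hcomm : ∀ a : H.endAlg, (a : Module.End ℚ V) ∘ₗ g = g ∘ₗ (a : Module.End ℚ V))
    {x : ℂ ⊗[ℚ] V}
    (hx : x ∈ ⨅ a : H.endAlg, Module.End.eigenspace ((a : Module.End ℚ V).baseChange ℂ) (σ a)) :
    g.baseChange ℂ x ∈
      ⨅ a : H.endAlg, Module.End.eigenspace ((a : Module.End ℚ V).baseChange ℂ) (σ a) := by
  rw [Submodule.mem_iInf] at hx ⊢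
  intro a
  rw [Module.End.mem_eigenspace_iff, ← LinearMap.comp_apply, ← LinearMap.baseChange_comp, hcomm a,
    LinearMap.baseChange_comp, LinearMap.comp_apply, Module.End.mem_eigenspace_iff.1 (hx a),
    map_smul]

section BlockDet

variable [Module.Finite ℚ V]

/-- **The blocks span `V_ℂ`** (`T ⊗_ℚ ℂ = ⊕_σ T_σ`, Huybrechts Rem. 3.3.14 (iii)): with a
primitive element `θ` of the field `E` (`exists_forall_eq_aeval`), `V_ℂ = ⊕_μ Eig_μ(θ_ℂ)`
(`iSup_eigenspace_baseChange_eq_top`) and each eigenspace of `θ_ℂ` lies in the block of its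
character (`exists_ringHom_forall_baseChange_apply_eq_smul`).
[cite: Huybrechts2016K3, Rem. 3.3.14 (iii)] -/
theorem iSup_iInf_eigenspace_baseChange_eq_top (hF : IsField H.endAlg) :
    ⨆ σ : H.endAlg →+* ℂ, ⨅ a : H.endAlg,
      Module.End.eigenspace ((a : Module.End ℚ V).baseChange ℂ) (σ a) = ⊤ := by
  obtain ⟨θ, hgen⟩ := exists_forall_eq_aeval hF
  rw [eq_top_iff, ← iSup_eigenspace_baseChange_eq_top hF θ]
  refine iSup_le fun μ => ?_
  by_cases hμ : Module.End.HasEigenvalue ((θ : Module.End ℚ V).baseChange ℂ) μ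
  · obtain ⟨φ, -, hφ⟩ := exists_ringHom_forall_baseChange_apply_eq_smul θ hgen hμ
    refine le_iSup_of_le φ fun x hx => ?_
    rw [Submodule.mem_iInf]
    intro a
    rw [Module.End.mem_eigenspace_iff]
    exact hφ a x hx
  · rw [Module.End.hasEigenvalue_iff, not_not] at hμ
    rw [hμ]
    exact bot_le

set_option maxHeartbeats 800000 in
-- the instance-heavy change of base ring `ℂ ⊗_ℚ V → ℂ ⊗_{Z,σ} V` exceeds the default budget
/-- **`det_ℂ(g_ℂ|_{T_σ}) = σ(det_Z g')`.** Let `E = End_Hdg(V)` be a field, `Z` its centre,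
`σ : E → ℂ` a character with block `T_σ = {x ∈ V_ℂ | a_ℂ x = σ(a) x ∀ a}`, and `g` the underlying
`ℚ`-linear map of a `Z`-linear `g'` with `g_ℂ(T_σ) ⊆ T_σ`. Then the determinant of `g_ℂ`
restricted to `T_σ` is `σ(det_Z g')`: the canonical surjection `Ψ_σ : ℂ ⊗_ℚ V → ℂ ⊗_{Z,σ} V`
restricts to an isomorphism `T_σ ≅ ℂ ⊗_{Z,σ} V` (it kills the other blocks, which together with
`T_σ` span `V_ℂ`, and `dim T_σ ≤ dim_Z V`) conjugating `g_ℂ|_{T_σ}` to `g' ⊗_{Z,σ} ℂ`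
(van Geemen Lemma 2.5: `GL(T)_K(ℂ) ≅ ∏_σ GL(T_σ)`; Huybrechts Rem. 3.3.14 (iii)).
[cite: vanGeemen2008RealMultK3, Lemma 2.5] [cite: Huybrechts2016K3, Rem. 3.3.14 (iii)] -/
theorem det_restrict_baseChange_eq (hF : IsField H.endAlg) (σ : H.endAlg →+* ℂ) {g : V →ₗ[ℚ] V}
    {g' : V →ₗ[Subalgebra.center ℚ H.endAlg] V} (hgg' : ∀ v, g' v = g v)
    (hT : ∀ x ∈ ⨅ a : H.endAlg, Module.End.eigenspace ((a : Module.End ℚ V).baseChange ℂ) (σ a),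
      g.baseChange ℂ x ∈
        ⨅ a : H.endAlg, Module.End.eigenspace ((a : Module.End ℚ V).baseChange ℂ) (σ a)) :
    LinearMap.det ((g.baseChange ℂ).restrict hT) =
      σ (LinearMap.det g' : Subalgebra.center ℚ H.endAlg) := by
  classical
  set T := ⨅ a : H.endAlg, Module.End.eigenspace ((a : Module.End ℚ V).baseChange ℂ) (σ a)
    with hTdef
  letI : Field H.endAlg := hF.toField
  haveI : IsScalarTower ℚ (Subalgebra.center ℚ H.endAlg) V := ⟨fun q z v => by
    change (((q • z : Subalgebra.center ℚ H.endAlg) : H.endAlg) : Module.End ℚ V) v =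
      q • ((z : H.endAlg) : Module.End ℚ V) v
    rw [Subalgebra.coe_smul, Subalgebra.coe_smul, LinearMap.smul_apply]⟩
  -- a `Z`-basis of `V`, transported from an `E`-basis along `E ≅ Z`
  obtain ⟨d, bZ, hv⟩ : ∃ (d : ℕ) (bZ : Module.Basis (Fin d) (Subalgebra.center ℚ H.endAlg) V),
      ⊤ ≤ Submodule.span H.endAlg (Set.range fun i => bZ i) := by
    haveI : IsScalarTower ℚ H.endAlg V := ⟨fun q a v => by
      change ((q • a : H.endAlg) : Module.End ℚ V) v = q • ((a : Module.End ℚ V) v)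
      rw [Subalgebra.coe_smul, LinearMap.smul_apply]⟩
    haveI : Module.Finite ℚ H.endAlg := finiteDimensional_endAlg H
    haveI : Module.Finite H.endAlg V := Module.Finite.of_restrictScalars_finite ℚ H.endAlg V
    let bE := Module.finBasis H.endAlg V
    let f : H.endAlg ≃+* Subalgebra.center ℚ H.endAlg :=
      { toFun := fun a => ⟨a, by
          rw [Subalgebra.mem_center_iff]
          intro c
          exact hF.mul_comm c a⟩
        invFun := fun z => z.1
        left_inv := fun _ => rfl
        right_inv := fun _ => rfl
        map_mul' := fun _ _ => rfl
        map_add' := fun _ _ => rfl }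
    refine ⟨_, bE.mapCoeffs f (fun c x => rfl), ?_⟩
    intro x _
    have hx : x ∈ Submodule.span H.endAlg (Set.range bE) := by
      rw [bE.span_eq]
      exact Submodule.mem_top
    have hrange : (Set.range fun i => bE.mapCoeffs f (fun c x => rfl) i) = Set.range bE := by
      congr 1
      funext i
      exact bE.mapCoeffs_apply f _ i
    rw [hrange]
    exact hx
  haveI : Module.Free (Subalgebra.center ℚ H.endAlg) V := Module.Free.of_basis bZ
  haveI : Module.Finite (Subalgebra.center ℚ H.endAlg) V := Module.Finite.of_basis bZ
  -- `ℂ` as a `Z`-algebra through `σ`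
  let σZ : Subalgebra.center ℚ H.endAlg →+* ℂ :=
    σ.comp (Subalgebra.center ℚ H.endAlg).val.toRingHom
  letI : Algebra (Subalgebra.center ℚ H.endAlg) ℂ := σZ.toAlgebra
  have hsmul : ∀ (z : Subalgebra.center ℚ H.endAlg) (c : ℂ), z • c = σ (z : H.endAlg) * c :=
    fun z c => rfl
  haveI : IsScalarTower ℚ (Subalgebra.center ℚ H.endAlg) ℂ := ⟨fun q z c => by
    rw [hsmul, hsmul, Subalgebra.coe_smul, map_rat_smul, smul_mul_assoc]⟩
  haveI : SMulCommClass (Subalgebra.center ℚ H.endAlg) ℚ ℂ := ⟨fun z q c => by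
    rw [hsmul, hsmul, mul_smul_comm]⟩
  -- the canonical surjection `Ψ : ℂ ⊗_ℚ V → ℂ ⊗_{Z,σ} V`
  let Ψ : ℂ ⊗[ℚ] V →ₗ[ℂ] ℂ ⊗[Subalgebra.center ℚ H.endAlg] V :=
    TensorProduct.mapOfCompatibleSMul (Subalgebra.center ℚ H.endAlg) ℚ ℂ ℂ V
  have hΨ : ∀ (c : ℂ) (v : V), Ψ (c ⊗ₜ[ℚ] v) = c ⊗ₜ[Subalgebra.center ℚ H.endAlg] v :=
    fun c v => TensorProduct.mapOfCompatibleSMul_tmul _ _ _ _ _ c v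
  haveI : IsScalarTower (Subalgebra.center ℚ H.endAlg) (Subalgebra.center ℚ H.endAlg) ℂ :=
    IsScalarTower.left _
  haveI : IsScalarTower (Subalgebra.center ℚ H.endAlg) (Subalgebra.center ℚ H.endAlg) V :=
    IsScalarTower.left _
  -- `Ψ a_ℂ = σ(a) Ψ`
  have hΨa : ∀ (a : H.endAlg) (x : ℂ ⊗[ℚ] V),
      Ψ ((a : Module.End ℚ V).baseChange ℂ x) = σ a • Ψ x := by
    intro a x
    have ha : a ∈ Subalgebra.center ℚ H.endAlg :=
      Subalgebra.mem_center_iff.2 fun b => hF.mul_comm b a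
    induction x using TensorProduct.induction_on with
    | zero => simp only [map_zero, smul_zero]
    | tmul c v =>
      rw [LinearMap.baseChange_tmul, hΨ, hΨ]
      have h1 : (a : Module.End ℚ V) v = (⟨a, ha⟩ : Subalgebra.center ℚ H.endAlg) • v := rfl
      have h2 : (⟨a, ha⟩ : Subalgebra.center ℚ H.endAlg) • c = σ a * c := rfl
      have h3 : c ⊗ₜ[Subalgebra.center ℚ H.endAlg] ((⟨a, ha⟩ : Subalgebra.center ℚ H.endAlg) • v) =
          ((⟨a, ha⟩ : Subalgebra.center ℚ H.endAlg) • c) ⊗ₜ[Subalgebra.center ℚ H.endAlg] v :=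
        (TensorProduct.smul_tmul _ _ _).symm
      rw [h1, h3, h2, TensorProduct.smul_tmul', smul_eq_mul]
    | add x y hx hy => simp only [map_add, smul_add, hx, hy]
  -- `Ψ g_ℂ = (g' ⊗ ℂ) Ψ`
  have hΨg : ∀ x, Ψ (g.baseChange ℂ x) = (g'.baseChange ℂ) (Ψ x) := by
    intro x
    induction x using TensorProduct.induction_on with
    | zero => simp only [map_zero]
    | tmul c v => rw [LinearMap.baseChange_tmul, hΨ, hΨ, LinearMap.baseChange_tmul, hgg']
    | add x y hx hy => simp only [map_add, hx, hy]
  -- `Ψ|_T` is onto: `Ψ` kills the other blocks, and the blocks span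
  have hΨT : ∀ w, ∃ y ∈ T, Ψ y = w := by
    intro w
    obtain ⟨x, rfl⟩ :=
      TensorProduct.mapOfCompatibleSMul_surjective (Subalgebra.center ℚ H.endAlg) ℚ ℂ ℂ V w
    have hx : x ∈ ⨆ τ : H.endAlg →+* ℂ, ⨅ a : H.endAlg,
        Module.End.eigenspace ((a : Module.End ℚ V).baseChange ℂ) (τ a) := by
      rw [iSup_iInf_eigenspace_baseChange_eq_top hF]
      exact Submodule.mem_top
    induction hx using Submodule.iSup_induction' with
    | mem τ x hx =>
      by_cases hτ : τ = σ
      · subst hτ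
        exact ⟨x, hx, rfl⟩
      · refine ⟨0, T.zero_mem, ?_⟩
        obtain ⟨a, ha⟩ : ∃ a : H.endAlg, τ a ≠ σ a := by
          by_contra h
          push Not at h
          exact hτ (RingHom.ext h)
        have h1 : (a : Module.End ℚ V).baseChange ℂ x = τ a • x :=
          Module.End.mem_eigenspace_iff.1 ((Submodule.mem_iInf _).1 hx a)
        have h2 := hΨa a x
        rw [h1, map_smul] at h2
        have h3 : (τ a - σ a) • Ψ x = 0 := by rw [sub_smul, h2, sub_self]
        rw [map_zero]
        exact ((smul_eq_zero.1 h3).resolve_left (sub_ne_zero.2 ha)).symm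
    | zero => exact ⟨0, T.zero_mem, rfl⟩
    | add x y _ _ hx hy =>
      obtain ⟨x', hx', hx'e⟩ := hx
      obtain ⟨y', hy', hy'e⟩ := hy
      exact ⟨x' + y', T.add_mem hx' hy', by rw [map_add, map_add, hx'e, hy'e]⟩
  -- dimensions: `dim T ≤ d = dim (ℂ ⊗_Z V)`
  obtain ⟨θ, hgen⟩ := exists_forall_eq_aeval hF
  have hss := iSup_eigenspace_baseChange_eq_top hF θ
  have hTle : T ≤ Module.End.eigenspace ((θ : Module.End ℚ V).baseChange ℂ) (σ θ) := iInf_le _ θ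
  have hdimT : Module.finrank ℂ T ≤ d := by
    refine (Submodule.finrank_mono hTle).trans ?_
    have h := finrank_eigenspace_baseChange_le_card (E := H.endAlg) hF.mul_comm θ hgen hss
      (fun i => bZ i) hv (σ θ)
    rwa [Fintype.card_fin] at h
  let bW := Algebra.TensorProduct.basis ℂ bZ
  haveI : Module.Finite ℂ (ℂ ⊗[Subalgebra.center ℚ H.endAlg] V) := Module.Finite.of_basis bW
  have hdimW : Module.finrank ℂ (ℂ ⊗[Subalgebra.center ℚ H.endAlg] V) = d := by
    rw [Module.finrank_eq_card_basis bW, Fintype.card_fin]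
  let ΨT : T →ₗ[ℂ] ℂ ⊗[Subalgebra.center ℚ H.endAlg] V := Ψ.comp T.subtype
  have hsurj : Function.Surjective ΨT := fun w => by
    obtain ⟨y, hy, hyw⟩ := hΨT w
    exact ⟨⟨y, hy⟩, hyw⟩
  have hdimT' : Module.finrank ℂ T = d := by
    refine le_antisymm hdimT ?_
    have h1 := LinearMap.finrank_range_le ΨT
    rw [LinearMap.range_eq_top.2 hsurj, finrank_top, hdimW] at h1
    exact h1
  have hinj : Function.Injective ΨT :=
    (LinearMap.injective_iff_surjective_of_finrank_eq_finrank (hdimT'.trans hdimW.symm)).2 hsurj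
  let e : T ≃ₗ[ℂ] ℂ ⊗[Subalgebra.center ℚ H.endAlg] V := LinearEquiv.ofBijective ΨT ⟨hinj, hsurj⟩
  have he : ∀ x : T, e x = Ψ x := fun x => LinearEquiv.ofBijective_apply _ x
  -- `Ψ|_T` conjugates `g_ℂ|_T` to `g' ⊗_Z ℂ`
  have hconj : (g.baseChange ℂ).restrict hT =
      (e.symm : _ →ₗ[ℂ] T) ∘ₗ (g'.baseChange ℂ) ∘ₗ (e : T →ₗ[ℂ] _) := by
    refine LinearMap.ext fun x => e.injective ?_
    rw [LinearMap.comp_apply, LinearMap.comp_apply, LinearEquiv.coe_coe, LinearEquiv.coe_coe,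
      LinearEquiv.apply_symm_apply, he, he, ← hΨg, LinearMap.coe_restrict_apply]
  rw [hconj]
  have hdc := LinearMap.det_conj (g'.baseChange ℂ) e.symm
  rw [LinearEquiv.symm_symm] at hdc
  rw [hdc, LinearMap.det_baseChange, RingHom.algebraMap_toAlgebra]
  rfl

/-- **`det_Z g' = 1 ⟹ det_ℂ(g_ℂ|_{T_σ}) = 1` for every character `σ`** — the block form of the
`SO_K`/`SL_K` condition in Zarhin's theorem (Huybrechts Thm. 3.3.9: `Hdg(T) = SO_K(T)`, with
`SO(T)_K(ℂ) ≅ ∏_σ SO(T_σ)`, van Geemen Lemma 2.5). [cite: Huybrechts2016K3, Thm. 3.3.9]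
[cite: vanGeemen2008RealMultK3, Lemma 2.5] -/
theorem det_restrict_baseChange_eq_one (hF : IsField H.endAlg) (σ : H.endAlg →+* ℂ)
    {g : V →ₗ[ℚ] V} {g' : V →ₗ[Subalgebra.center ℚ H.endAlg] V} (hgg' : ∀ v, g' v = g v)
    (hdet : LinearMap.det g' = (1 : Subalgebra.center ℚ H.endAlg))
    (hT : ∀ x ∈ ⨅ a : H.endAlg, Module.End.eigenspace ((a : Module.End ℚ V).baseChange ℂ) (σ a),
      g.baseChange ℂ x ∈
        ⨅ a : H.endAlg, Module.End.eigenspace ((a : Module.End ℚ V).baseChange ℂ) (σ a)) :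
    LinearMap.det ((g.baseChange ℂ).restrict hT) = 1 := by
  rw [det_restrict_baseChange_eq hF σ hgg' hT, hdet, OneMemClass.coe_one, map_one]

end BlockDet

end HodgeStructure

end Literature.AlgebraicGeometry.Motives

end
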